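import Literature.NumberTheory.ComplexMultiplication.SexticCMTypesB3NoFlip
import HarnessLib

/-!
# Index-six subgroups of the Galois image of a pair-flip sextic CM field: fix a point, or conjugate every point

Companion of `SexticCMTypesB3.lean` / `SexticCMTypesB3Abstract.lean` / `SexticCMTypesB3NoFlip.lean` (the model
`W(B₃) = C_{𝔖₆}(cc)` of the Galois group of a sextic CM field acting on its six complex embeddings; sign changes `f0 f1 f2`,
rotation `rot`; a subgroup `𝒢 ≤ W` of order `24` is `{f0^a f1^b f2^c rot^k}`).  Dodson's sextic CM fields WITH pair flips
have Galois image `𝒢 ≤ W` containing `f0, f1, f2` and transitive, hence of order `24` or `48` (`card_eq_of_flips_of_transitive`).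
For such `𝒢` this file proves the dichotomy behind «twin sextic fields in one Galois closure share no constituent»:

> **`fixes_or_conjugates`**.  Let `H ≤ 𝒢` have index `6` (`6 · |H| = |𝒢|`) and `cc ∉ H`.  Then EITHER `H` fixes some point of
> `Fin 6`, OR for every point `i` some `h ∈ H` maps `i` to its conjugate `cc i`.

(For the Galois group `G = Aut(ℂ)` of a pair-flip sextic CM field `K` acting on `Hom(K, ℂ) ≅ Fin 6` and `H` the image of the
stabiliser of an embedding `y` of another sextic CM field `K' ⊂ L = K^{gal}`: the first alternative says `x(K) ⊆ y(K')`,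
i.e. `K ≅ K'`; the second says that no odd weight on `Hom(K, ℂ)` is fixed by `Aut(ℂ/y(K'))` — criterion (δ) of
`CMTypeRankFixedVectorCriteria`.)

PROOF.  `|H| ∈ {4, 8}`.  If some `i₀` is NOT conjugated by `H`, the `H`-orbit `O` of `i₀` is disjoint from `cc(O)`, so
`|O| ≤ 3`; `|O|` divides `|H|`, so `|O| ∈ {1, 2}`; `|O| = 1` is a fixed point.  If `O = {i₀, i₁}` then every element of `H`
preserves `{i₀, i₁}`, and the elements of `W` preserving such a pair (with `i₁ ≠ i₀, cc i₀`) are FOUR (`card_filter_pair`);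
so `|H| = 4`, `|𝒢| = 24`, and `H` contains the pair-swap `swap i₀ i₁ · swap (cc i₀) (cc i₁)` — a block TRANSPOSITION, which
is not among the `24` words `f0^a f1^b f2^c rot^k` (`pairSwap_not_mem_words`).  Finite group theory in `𝔖₆` (`decide`);
theorems only, no `sorry`.

## References
* [Dodson1984] B. Dodson, *The structure of Galois groups of CM-fields*, Trans. AMS 283 (1984), §1.1 Imprimitivity
  Theorem, §5.1.2 Theorem.
* [Serre1977] J.-P. Serre, *Linear Representations of Finite Groups*, GTM 42, §2.2.
-/

set_option autoImplicit false

namespace Literature.NumberTheory.ComplexMultiplication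

namespace SexticB3

open Equiv

/-! ### Computations in `W(B₃)` -/

section Computations

set_option maxRecDepth 20000 in
/-- **Sign normalisation**: every element of `W` is a sign change times a «pure» block permutation (a lift of `𝔖₃`,
one of `1, rot, rot², s01, s02, s12`) — for each word `w ∈ W` some `f0^a f1^b f2^c · w` is pure. [cite: Dodson1984, §1.1 Imprimitivity Theorem] -/
private theorem exists_signs_mul_mem_pure6 : ∀ v : (Fin 2 × Fin 2 × Fin 2 × Fin 3) × Fin 2,
    ∃ u : Fin 2 × Fin 2 × Fin 2, f0 ^ (u.1 : ℕ) * f1 ^ (u.2.1 : ℕ) * f2 ^ (u.2.2 : ℕ) * word' v ∈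
      ({1, rot, rot * rot, s01, s02, s12} : Finset (Perm (Fin 6))) := by
  decide +kernel

set_option maxRecDepth 20000 in
/-- A pure block permutation sending `0 ↦ 1` is `s01` or `rot`; sending `0 ↦ 2` it is `s02` or `rot²`. [folklore] -/
private theorem pure6_apply_zero : ∀ p ∈ ({1, rot, rot * rot, s01, s02, s12} : Finset (Perm (Fin 6))),
    (p 0 = 1 ∨ p 0 = cc 1 → p = s01 ∨ p = rot) ∧ (p 0 = 2 ∨ p 0 = cc 2 → p = s02 ∨ p = rot * rot) := by
  decide

/-- Sign changes preserve each block: `(f0^a f1^b f2^c w) 0 ∈ {w 0, cc (w 0)}`… stated as: the place of `0`. [folklore] -/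
private theorem signs_apply_eq_or : ∀ (u : Fin 2 × Fin 2 × Fin 2) (j : Fin 6),
    (f0 ^ (u.1 : ℕ) * f1 ^ (u.2.1 : ℕ) * f2 ^ (u.2.2 : ℕ)) j = j ∨
      (f0 ^ (u.1 : ℕ) * f1 ^ (u.2.1 : ℕ) * f2 ^ (u.2.2 : ℕ)) j = cc j := by
  decide

/-- The two block transpositions generate the rotation: `s02 · s01 ∈ {rot, rot²}`. [folklore] -/
private theorem s02_mul_s01 : s02 * s01 = rot ∨ s02 * s01 = rot * rot := by decide

/-- `rot = (rot²)²`. [folklore] -/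
private theorem rot_eq_sq_sq : rot = (rot * rot) * (rot * rot) := by decide

set_option maxRecDepth 20000 in
/-- **Four elements of `W` preserve a given non-conjugate pair `{i₀, i₁}`** (`i₁ ∉ {i₀, cc i₀}`): identity or swap on the pair
(and accordingly on the conjugate pair), identity or swap on the remaining block. [cite: Dodson1984, §1.1 Imprimitivity Theorem] -/
private theorem card_filter_pair : ∀ i₀ i₁ : Fin 6, i₁ ≠ i₀ → i₁ ≠ cc i₀ →
    (Finset.univ.filter fun w : Perm (Fin 6) => w * cc = cc * w ∧ (w i₀ = i₀ ∨ w i₀ = i₁) ∧ (w i₁ = i₀ ∨ w i₁ = i₁)).card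
      = 4 := by
  decide

/-- The pair-swap `swap i₀ i₁ · swap (cc i₀) (cc i₁)` lies in `W`, preserves `{i₀, i₁}`, and is NOT one of the `24` words
`f0^a f1^b f2^c rot^k` (it transposes two blocks). [cite: Dodson1984, §5.1.2 Theorem] -/
private theorem pairSwap_facts : ∀ i₀ i₁ : Fin 6, i₁ ≠ i₀ → i₁ ≠ cc i₀ →
    (swap i₀ i₁ * swap (cc i₀) (cc i₁)) * cc = cc * (swap i₀ i₁ * swap (cc i₀) (cc i₁)) ∧
      ((swap i₀ i₁ * swap (cc i₀) (cc i₁)) i₀ = i₀ ∨ (swap i₀ i₁ * swap (cc i₀) (cc i₁)) i₀ = i₁) ∧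
      ((swap i₀ i₁ * swap (cc i₀) (cc i₁)) i₁ = i₀ ∨ (swap i₀ i₁ * swap (cc i₀) (cc i₁)) i₁ = i₁) ∧
      swap i₀ i₁ * swap (cc i₀) (cc i₁) ∉ Finset.univ.image word := by
  decide

end Computations

/-! ### Transitive subgroups with sign changes have order `24` or `48` -/

section Order

/-- **Sign changes at all three places and transitivity force `rot ∈ 𝒢`**: normalise an element sending `0` into the
block of `1` (resp. `2`) by sign changes to a pure block permutation, `s01` or `rot` (resp. `s02` or `rot²`), and
`s02 · s01 ∈ {rot, rot²}`. [cite: Dodson1984, §5.1.2 Theorem] -/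
theorem rot_mem_of_flips_of_transitive (𝒢 : Subgroup (Perm (Fin 6))) (hW : 𝒢 ≤ W) (hf0 : f0 ∈ 𝒢) (hf1 : f1 ∈ 𝒢)
    (hf2 : f2 ∈ 𝒢) (htrans : ∀ j : Fin 6, ∃ g ∈ 𝒢, g 0 = j) : rot ∈ 𝒢 := by
  have hsigns : ∀ u : Fin 2 × Fin 2 × Fin 2, f0 ^ (u.1 : ℕ) * f1 ^ (u.2.1 : ℕ) * f2 ^ (u.2.2 : ℕ) ∈ 𝒢 := fun u =>
    𝒢.mul_mem (𝒢.mul_mem (𝒢.pow_mem hf0 _) (𝒢.pow_mem hf1 _)) (𝒢.pow_mem hf2 _)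
  -- a pure element of `𝒢` over each of `1`, `2`
  have hpure : ∀ j : Fin 6, ∃ p ∈ ({1, rot, rot * rot, s01, s02, s12} : Finset (Perm (Fin 6))),
      p ∈ 𝒢 ∧ (p 0 = j ∨ p 0 = cc j) := by
    intro j
    obtain ⟨g, hg, hg0⟩ := htrans j
    obtain ⟨v, hv⟩ := exists_word'_eq (mem_W.1 (hW hg))
    obtain ⟨u, hu⟩ := exists_signs_mul_mem_pure6 v
    refine ⟨_, hu, 𝒢.mul_mem (hsigns u) (hv ▸ hg), ?_⟩
    rw [Perm.mul_apply, hv, hg0]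
    exact signs_apply_eq_or u j
  obtain ⟨p₁, hp₁, hp₁𝒢, hp₁0⟩ := hpure 1
  obtain ⟨p₂, hp₂, hp₂𝒢, hp₂0⟩ := hpure 2
  rcases (pure6_apply_zero p₁ hp₁).1 hp₁0 with rfl | rfl
  · rcases (pure6_apply_zero p₂ hp₂).2 hp₂0 with rfl | rfl
    · rcases s02_mul_s01 with h | h
      · rw [← h]; exact 𝒢.mul_mem hp₂𝒢 hp₁𝒢
      · rw [rot_eq_sq_sq, ← h]; exact 𝒢.mul_mem (𝒢.mul_mem hp₂𝒢 hp₁𝒢) (𝒢.mul_mem hp₂𝒢 hp₁𝒢)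
    · rw [rot_eq_sq_sq]; exact 𝒢.mul_mem hp₂𝒢 hp₂𝒢
  · exact hp₁𝒢

/-- **A transitive subgroup of `W(B₃)` containing the three sign changes has order `24` or `48`** (it contains the `24` words
`f0^a f1^b f2^c rot^k`, and its order divides `48`) — the Galois groups of the sextic CM fields WITH pair flips.
[cite: Dodson1984, §5.1.2 Theorem] -/
theorem card_eq_of_flips_of_transitive (𝒢 : Subgroup (Perm (Fin 6))) (hW : 𝒢 ≤ W) (hf0 : f0 ∈ 𝒢) (hf1 : f1 ∈ 𝒢)
    (hf2 : f2 ∈ 𝒢) (htrans : ∀ j : Fin 6, ∃ g ∈ 𝒢, g 0 = j) : Nat.card 𝒢 = 24 ∨ Nat.card 𝒢 = 48 := by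
  have hrot := rot_mem_of_flips_of_transitive 𝒢 hW hf0 hf1 hf2 htrans
  have h24 : 24 ≤ Nat.card 𝒢 := words_le_card hf0 hf1 hf2 hrot
  have hdvd : Nat.card 𝒢 ∣ 48 := by rw [← card_W]; exact Subgroup.card_dvd_of_le hW
  have hle : Nat.card 𝒢 ≤ 48 := Nat.le_of_dvd (by norm_num) hdvd
  interval_cases h : Nat.card 𝒢 <;> omega

end Order

/-! ### Index-six subgroups: a fixed point, or every point conjugated -/

section IndexSix

/-- **The dichotomy.**  `𝒢 ≤ W` transitive with the three sign changes and `cc`; `H ≤ 𝒢` of index six (`6 · |H| = |𝒢|`).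
Then `H` fixes a point of `Fin 6`, or maps every point to its conjugate by some element.
[cite: Dodson1984, §5.1.2 Theorem] [cite: Serre1977, §2.2] -/
theorem fixes_or_conjugates (𝒢 H : Subgroup (Perm (Fin 6))) (hW : 𝒢 ≤ W) (hHG : H ≤ 𝒢) (hf0 : f0 ∈ 𝒢)
    (hf1 : f1 ∈ 𝒢) (hf2 : f2 ∈ 𝒢) (hcc : cc ∈ 𝒢) (htrans : ∀ j : Fin 6, ∃ g ∈ 𝒢, g 0 = j)
    (hidx : Nat.card H * 6 = Nat.card 𝒢) :
    (∃ i, ∀ h ∈ H, h i = i) ∨ (∀ i, ∃ h ∈ H, h i = cc i) := by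
  classical
  by_contra hcon
  have hnofix : ∀ i, ∃ h ∈ H, h i ≠ i := fun i => by
    by_contra h'
    push Not at h'
    exact hcon (Or.inl ⟨i, h'⟩)
  obtain ⟨i₀, hi₀⟩ : ∃ i₀, ∀ h ∈ H, h i₀ ≠ cc i₀ := by
    by_contra h'
    push Not at h'
    exact hcon (Or.inr h')
  have hcardG := card_eq_of_flips_of_transitive 𝒢 hW hf0 hf1 hf2 htrans
  have hH : Nat.card H = 4 ∨ Nat.card H = 8 := by rcases hcardG with h | h <;> omega
  have hHW : ∀ h ∈ H, h * cc = cc * h := fun h hh => mem_W.1 (hW (hHG hh))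
  -- the orbit of `i₀` under `H`
  set O : Set (Fin 6) := MulAction.orbit (↥H) i₀ with hO_def
  have hmemO : ∀ j, j ∈ O ↔ ∃ h ∈ H, h i₀ = j := fun j => by
    rw [hO_def, MulAction.mem_orbit_iff]
    constructor
    · rintro ⟨⟨h, hh⟩, rfl⟩; exact ⟨h, hh, rfl⟩
    · rintro ⟨h, hh, rfl⟩; exact ⟨⟨h, hh⟩, rfl⟩
  have hi₀O : i₀ ∈ O := MulAction.mem_orbit_self i₀
  -- `|O|` divides `|H|`
  have hOdvd : O.ncard ∣ Nat.card H := by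
    rw [← MulAction.index_stabilizer]
    exact Dvd.intro_left _ (MulAction.stabilizer (↥H) i₀).card_mul_index
  -- `O` is disjoint from `cc(O)`, so `|O| ≤ 3`
  have hOcc : ∀ j ∈ O, cc j ∉ O := by
    intro j hj hccj
    obtain ⟨h, hh, rfl⟩ := (hmemO _).1 hj
    obtain ⟨h', hh', hh'eq⟩ := (hmemO _).1 hccj
    -- `(h⁻¹ h') i₀ = h⁻¹ (cc (h i₀)) = cc i₀`
    apply hi₀ (h⁻¹ * h') (H.mul_mem (H.inv_mem hh) hh')
    have hcomm : h⁻¹ * cc = cc * h⁻¹ := mem_W.1 (W.inv_mem (hW (hHG hh)))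
    calc (h⁻¹ * h') i₀ = h⁻¹ (cc (h i₀)) := by rw [Perm.mul_apply, hh'eq]
      _ = (h⁻¹ * cc) (h i₀) := rfl
      _ = (cc * h⁻¹) (h i₀) := by rw [hcomm]
      _ = cc i₀ := by simp
  have hOle : O.ncard ≤ 3 := by
    have hdisj : Disjoint O (cc '' O) := by
      rw [Set.disjoint_left]
      rintro j hj ⟨j', hj', rfl⟩
      exact hOcc j' hj' hj
    have h1 : (O ∪ cc '' O).ncard ≤ 6 := by
      have := Set.ncard_le_ncard (Set.subset_univ (O ∪ cc '' O)) Set.finite_univ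
      rwa [Set.ncard_univ, Nat.card_eq_fintype_card, Fintype.card_fin] at this
    rw [Set.ncard_union_eq hdisj (Set.toFinite _) (Set.toFinite _),
      Set.ncard_image_of_injective _ cc.injective] at h1
    omega
  have hOpos : 0 < O.ncard := Set.ncard_pos (Set.toFinite _) |>.2 ⟨i₀, hi₀O⟩
  -- hence `|O| ∈ {1, 2}`
  have hO12 : O.ncard = 1 ∨ O.ncard = 2 := by
    rcases hH with h4 | h8
    · rw [h4] at hOdvd
      have := Nat.le_of_dvd (by norm_num) hOdvd
      interval_cases hO : O.ncard <;> simp_all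
    · rw [h8] at hOdvd
      interval_cases hO : O.ncard <;> simp_all
  rcases hO12 with hO1 | hO2
  · -- a fixed point
    obtain ⟨j, hj⟩ := Set.ncard_eq_one.1 hO1
    have hji : j = i₀ := by
      have : i₀ ∈ ({j} : Set (Fin 6)) := hj ▸ hi₀O
      exact (Set.mem_singleton_iff.1 this).symm
    obtain ⟨h, hh, hne⟩ := hnofix i₀
    apply hne
    have : h i₀ ∈ O := (hmemO _).2 ⟨h, hh, rfl⟩
    rw [hj, hji] at this
    exact Set.mem_singleton_iff.1 this
  · -- `O = {i₀, i₁}`: `H` sits inside the four elements of `W` preserving the pair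
    obtain ⟨x, y, hxy, hOxy⟩ := Set.ncard_eq_two.1 hO2
    obtain ⟨i₁, hi₁O, hi₁ne⟩ : ∃ i₁ ∈ O, i₁ ≠ i₀ := by
      by_cases hx : x = i₀
      · exact ⟨y, hOxy ▸ by simp, fun h => hxy (hx.trans h.symm)⟩
      · exact ⟨x, hOxy ▸ by simp, hx⟩
    have hi₁cc : i₁ ≠ cc i₀ := fun h => hOcc i₀ hi₀O (h ▸ hi₁O)
    have hmem2 : ∀ j ∈ O, j = x ∨ j = y := fun j hj => by
      rw [hOxy] at hj
      simpa only [Set.mem_insert_iff, Set.mem_singleton_iff] using hj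
    have hOsub : ∀ j ∈ O, j = i₀ ∨ j = i₁ := by
      intro j hj
      by_cases hji : j = i₀
      · exact Or.inl hji
      · right
        rcases hmem2 i₀ hi₀O with h0 | h0
        · have hj' : j = y := (hmem2 j hj).resolve_left (fun e => hji (e.trans h0.symm))
          have h1' : i₁ = y := (hmem2 i₁ hi₁O).resolve_left (fun e => hi₁ne (e.trans h0.symm))
          rw [hj', h1']
        · have hj' : j = x := (hmem2 j hj).resolve_right (fun e => hji (e.trans h0.symm))
          have h1' : i₁ = x := (hmem2 i₁ hi₁O).resolve_right (fun e => hi₁ne (e.trans h0.symm))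
          rw [hj', h1']
    set F : Finset (Perm (Fin 6)) := Finset.univ.filter fun w : Perm (Fin 6) =>
      w * cc = cc * w ∧ (w i₀ = i₀ ∨ w i₀ = i₁) ∧ (w i₁ = i₀ ∨ w i₁ = i₁) with hF_def
    have hF4 : F.card = 4 := card_filter_pair i₀ i₁ hi₁ne hi₁cc
    have hHF : ∀ h ∈ H, h ∈ F := by
      intro h hh
      rw [hF_def, Finset.mem_filter]
      refine ⟨Finset.mem_univ _, hHW h hh, hOsub _ ((hmemO _).2 ⟨h, hh, rfl⟩), hOsub _ ?_⟩
      -- `h i₁ ∈ O`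
      obtain ⟨h₁, hh₁, rfl⟩ := (hmemO _).1 hi₁O
      exact (hmemO _).2 ⟨h * h₁, H.mul_mem hh hh₁, by rw [Perm.mul_apply]⟩
    -- `|H| ≤ 4`, so `|H| = 4` and `H = F`
    have hncard : Nat.card H = (H : Set (Perm (Fin 6))).ncard := Nat.card_coe_set_eq _
    have hHle : Nat.card H ≤ 4 := by
      have h1 : (H : Set (Perm (Fin 6))).ncard ≤ (F : Set (Perm (Fin 6))).ncard :=
        Set.ncard_le_ncard (fun h hh => Finset.mem_coe.2 (hHF h hh)) (Set.toFinite _)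
      rw [Set.ncard_coe_finset, hF4] at h1
      omega
    have hH4 : Nat.card H = 4 := by omega
    have hG24 : Nat.card 𝒢 = 24 := by omega
    -- the pair-swap lies in `F = H ≤ 𝒢`
    obtain ⟨hsW, hs0, hs1, hsnot⟩ := pairSwap_facts i₀ i₁ hi₁ne hi₁cc
    have hsF : swap i₀ i₁ * swap (cc i₀) (cc i₁) ∈ F := by
      rw [hF_def, Finset.mem_filter]; exact ⟨Finset.mem_univ _, hsW, hs0, hs1⟩
    have hHeqF : (H : Set (Perm (Fin 6))) = ↑F := by
      apply Set.eq_of_subset_of_ncard_le (fun h hh => Finset.mem_coe.2 (hHF h hh)) _ (Set.toFinite _)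
      rw [Set.ncard_coe_finset, hF4, ← hncard, hH4]
    have hsH : swap i₀ i₁ * swap (cc i₀) (cc i₁) ∈ H := by
      have : swap i₀ i₁ * swap (cc i₀) (cc i₁) ∈ (H : Set (Perm (Fin 6))) := by rw [hHeqF]; exact hsF
      exact this
    have hs𝒢 : swap i₀ i₁ * swap (cc i₀) (cc i₁) ∈ (𝒢 : Set (Perm (Fin 6))) := hHG hsH
    rw [coe_eq_words_of_card 𝒢 hW hcc hG24] at hs𝒢
    exact hsnot hs𝒢

end IndexSix

end SexticB3

end Literature.NumberTheory.ComplexMultiplication
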